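import Literature.MathematicalPhysics.QuantumFieldTheory.Balaban1983to89.B6BoxCharts

/-!
# `Balaban1983to89.B6BoxChartsCorners` — [Balaban1984PropagatorsII] Sect. A p. 231 (2.46) with (2.66) p. 234 and
Prop. 2.6 p. 247: CORNER INSTANCES of the two-scale model of `…Balaban1983to89.B6BoxCharts` §8 — a LEAF of that file
(cell pub-balaban, lineage pv08; the parent, v1.4, is IMPORTED and NOT modified: it has reached the gate's size cap of
200 000 bytes per file, so what would have been its §10 [v1.5] lives here, with the parent's namespace opened).
The parent's flat model (§8: the interface Σ a coordinate hyperplane {x_μ = 0}, the coarse region a half-lattice) is the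
case I = {μ} of two families indexed by a finite set I of coordinate directions, |I| = m ≤ d: the interface Σ with a
SALIENT corner (coarse region an orthant of the Lη-lattice in the directions I) or a RE-ENTRANT corner (coarse region a
union of half-lattices).  The comparison behind (2.66) (cell GAPS.md G-pv08-1) holds with the adjacent-scale constant
and the additive constant L − 1 at a salient corner and m(L − 1) at a re-entrant one — SHARP for every M ∈ L·ℕ₊ — and the
last «≤» of (2.66) follows with the constant e^{½δ₀m(L−1)}·c₀(δ₀, ½)^d, depending on d, L, δ₀ only, not on M.

CITATION HEADER (lean-in-tree rule 2026-08-18).  Source: T. Bałaban, *Propagators and renormalization transformations for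
lattice gauge theories. II*, Commun. Math. Phys. **96**, 223–250 (1984), doi:10.1007/bf01240221 (cell paper B6; held:
`paper:balaban1984-cmp96-propagators-rt-ii`; journal page = PDF page + 222).  NO NEW QUOTATION: the printed inputs this
leaf bears on are quoted verbatim, with page references and render file names, in the parent `…B6BoxCharts` — p. 223
[PDF 1] (the ℓ¹ distance), (2.2)–(2.4) p. 224 [2], Sect. A p. 231 [9] ((2.46), *"The domain Ω_j is a sum of cubes of the
size ML^jη."*), (2.66) p. 234 [12] (header of the parent) and Prop. 2.6 p. 247 [25] (docstring of the parent's §9: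
*"There exists a positive constant δ₃ depending on d and L only, such that … with the constant O(1) depending on d and
L only;"* — re-read for this leaf from the render `b2b-balaban-ref1/pages/1984-cmp96-propagators-rt-II/…-p025-x2.png`).
The lattice ℤ^d = `Site d`, its nearest-neighbour graph `zdGraph d`, `latL1Dist` (`Literature.Probability.LatticeModels.…`),
the parent's box charts (`CboxClosed`, `IsBoxChart`, `reachable_of_chart`, `dist_le_latL1Dist_of_chart`), its two-scale
model (`scalePt`, `twoScaleRel/Graph/Pts`, `latL1Dist_foot_le`, `natAbs_ediv_sub_le`, `exp_decay_transfer`), its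
potential lemma `le_add_dist_of_adj_le` (§9b) and its lattice sums `sum_exp_neg_latL1Dist_le_c0_pow` (§9a, with the
constant `B6.c0` of Lemma 2.1) are used BY NAME; nothing upstream is modified.

THE DICTIONARY (the parent's, continued).  A point of the η-lattice T_η near the interface is x ∈ ℤ^d (η-units); the
coarse lattice T^{(1)}_{Lη} is L·ℤ^d (`scalePt L y`); an ADMISSIBLE BOND is an η-bond with both ends in the FINE region F
(Λ₀-bonds inside B⁰(Λ₀), thickened by the overlap slab of one fine block below Σ as in the parent's §8) or an Lη-bond
{L·y, L·y′} with y, y′ Lη-neighbours in the COARSE region C (Λ₁-bonds inside B¹(Λ₁)); the two bond families are glued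
through the common points L·y ∈ F (the shared-point linkage of the parent's §3).  `regionGraph d L F C` (§10a) is this
bond graph for arbitrary F, C ⊆ ℤ^d; the parent's `twoScaleGraph d L M μ` is F = {x_μ < M}, C = {0 ≤ y_μ} (`rfl`).  A
SALIENT corner of Ω₁ in the directions I: C = ⋂_{i∈I}{0 ≤ y_i} (convex), F = ⋃_{i∈I}{x_i < M}; a RE-ENTRANT corner:
C = ⋃_{i∈I}{0 ≤ y_i}, F = ⋂_{i∈I}{x_i < M} (the pocket).  `dist` = the graph distance of the model = the number of bonds
of a shortest admissible contour, i.e. (2.46)'s Σ_j (L^jη)^{−1}|Γ ∩ B^j(Λ_j)| with every bond counted at the weight of its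
own lattice (1 per η-bond, 1 per Lη-bond), as in the parent's §§8e, 9.

PROVED [folklore model computations; every `theorem` below, no `sorry`, no new axiom].
1. §10a–b: the generic region model `regionGraph d L F C` (`regionGraph_flat` / `regionPts_flat`: the parent's §8a is an
   instance, by `rfl`); its charts `isBoxChart_region_fine` (a coordinate-box-closed B ⊆ F, drawn identically) and
   `isBoxChart_region_coarse` (B ⊆ C, drawn by `scalePt L`); membership / honesty lemmas; the coordinate bookkeeping
   `latL1Dist_update_split` (‖u − w‖₁ + ‖w − v‖₁ = ‖u − v‖₁ for w := u with u_i := v_i) and `latL1Dist_round_le` (one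
   rounding z := y with y_μ := ⌊u_μ/L⌋ costs ≤ L − 1: ‖u − L·z‖₁ + ‖z − y‖₁ ≤ ‖u − L·y‖₁ + (L − 1)).
2. §10c, the SALIENT corner `salientGraph d L M I` (I = {μ} is the parent's §8a: `salientGraph_singleton`,
   `salientPts_singleton`) KEEPS THE FLAT CONSTANTS — `salient_reachable_dist`: input (α) (any two points are joined) and
   `dist u v ≤ ‖u − v‖₁ + (L − 1)` for all u, v ∈ `salientPts d L M I` (M, L ≥ 1): the orthant is ONE chart
   (`cboxClosed_salientCoarse`, `salient_coarse`: ≤ ‖y − y′‖₁ in Lη-units); the union of fine half-spaces is crossed by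
   moving one coordinate first (`salient_fine`: ≤ ‖u − v‖₁, no loss); a fine point reaches a coarse one through at most
   ONE rounding (`salient_fine_coarse`: the foot of the parent's `latL1Dist_foot_le` when u_{i₁} ≤ 0, else
   `latL1Dist_round_le`); `salient_exp_decay_le`: e^{−δ‖u − v‖₁} ≤ e^{δ(L−1)}·e^{−δ·dist(u,v)} (δ ≥ 0).
3. §10d, the RE-ENTRANT corner `reentrantGraph d L M I` (`reentrantGraph_singleton`, `reentrantPts_singleton`) costs ONE
   ROUNDING PER RE-ENTRANT DIRECTION — `reentrant_reachable_dist`: (α) and `dist u v ≤ ‖u − v‖₁ + m(L − 1)`, m = |I|, for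
   all u, v ∈ `reentrantPts d L M I` (M, L ≥ 1): the pocket is one chart (`cboxClosed_reentrantFine`, `reentrant_fine`),
   the union of coarse half-lattices is crossed one coordinate first (`reentrant_coarse`), and a fine point u reaches L·y
   (y_{i₀} ≥ 0, i₀ ∈ I) through the coarse index `cornerFoot L I i₀ u y` (⌊u_i/L⌋ for i ∈ I, the coordinate i₀ lifted to
   0 when negative, y's coordinates outside I; `cornerFoot_mem_coarse`, `scalePt_cornerFoot_mem_fine`) at the cost
   `latL1Dist_cornerFoot_le`: ‖u − L·z‖₁ + ‖z − y‖₁ ≤ ‖u − L·y‖₁ + m(L − 1); `reentrant_exp_decay_le`: e^{−δ‖u − v‖₁} ≤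
   e^{δ·m(L−1)}·e^{−δ·dist(u,v)}.
4. §10e, SHARPNESS for every admissible block size: `reentrant_dist_cornerWitness` — for M = L·M′, M′ ≥ 1, L ≥ 1 and
   I ≠ ∅, the fine point (M − 1)·𝟙_I (`cornerFinePt`) and the coarse point M·𝟙_I = L·(M′·𝟙_I) (`cornerCoarseIdx`) are at
   ℓ¹ distance m (`latL1Dist_cornerWitness`) and at graph distance EXACTLY m·L = m + m(L − 1): the corner potential
   `cornerPotential I M L x = Σ_{i∈I} g(x_i)` (`cornerPot`: slope 1 on [M − L, M − 1], value L at M − 1, 0 from M on, ≤ 1 on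
   L·ℤ — `cornerPot_step`, `cornerPot_mul_le_one`, `cornerPot_pred`, `cornerPot_self`) changes by ≤ 1 along every bond
   (`cornerPotential_le_of_rel` / `_of_adj`, via `sum_le_sum_add_one`), is m·L at the fine point
   (`cornerPotential_cornerFinePt`) and 0 at the coarse one (`cornerPotential_cornerCoarse`), whence dist ≥ m·L by the
   parent's `le_add_dist_of_adj_le`.  So the additive constant m(L − 1) is attained for every M ∈ L·ℕ₊, not only M = L.
5. §10f, the last «≤» of (2.66) at a corner: generic `windowTerm_le_of_cmp`, `windowSum_le_of_cmp`, `sum266_le_of_cmp`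
   (under dist ≤ ‖·‖₁ + K on S and reachability: Σ_{y″∈S} e^{−δ₀‖y − y″‖₁}·e^{−½δ₀d(y″,y′)} ≤ e^{½δ₀K}·c₀(δ₀, ½)^d·
   e^{−½δ₀d(y,y′)}, δ₀ > 0, scale-correct weights as in the parent's §9c), instantiated as `salient_sum266_le` (constant
   e^{½δ₀(L−1)}·c₀(δ₀, ½)^d — the parent's `twoScale_sum266_le` constant) and `reentrant_sum266_le` (constant
   e^{½δ₀m(L−1)}·c₀(δ₀, ½)^d); m ≤ d, so both depend on d, L, δ₀ only and are UNIFORM IN M — the dependence p. 247 prints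
   for the O(1) of Prop. 2.6.

WHAT IS NOT PROVED / NOT CLAIMED.  Nothing printed is asserted; (2.46), (2.66), Prop. 2.2 / 2.6 and everything analytic
remain hypotheses of the siblings.  These are computations in a model with ONE corner of ONE interface between TWO
lattice scales on the INFINITE lattice: they decide the «corners of Σ_j» entry of the parent's located list (header of
`…B6BoxCharts`, WHAT IS NOT PROVED; GAPS.md G-pv08-1) in that setting only — a salient corner changes no constant, a
re-entrant corner in m ≤ d directions replaces the additive constant L − 1 by m(L − 1) (sharp) and the shift factor
e^{½δ₀(L−1)} by e^{½δ₀m(L−1)}, still d, L, δ₀ only.  Bałaban's Ω_j (arbitrary unions of big cubes *"of the size ML^jη"*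
subject to (2.2): several corners of both kinds, routes that must stay inside Ω between them), THREE levels j − 1, j,
j + 1 at once, k > 1, the torus identification and the cover 𝒟 of p. 229 remain LOCATED exactly as the parent states
them; WHICH boxes are charts of Bałaban's admissible class is the parent's located input, unchanged.  VALUE: bookkeeping
— a kernel certificate that corners of the interface cost at most a d, L-dependent additive constant in the model, and
exactly that much at a re-entrant corner; NOT progress on any disputed estimate.
-/

namespace Literature.MathematicalPhysics.QuantumFieldTheory.Balaban1983to89.B6BoxChartsCorners

open Literature.Probability.LatticeModels
open B6Geometry B6LevelGapMetric B6BoxCharts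

/-! ## 10. CORNER INSTANCES of the two-scale model: salient and re-entrant corners of Σ [folklore model computations;
nothing printed is asserted] — numbered §10 to continue the parent's §§1–9 -/

section Corner

variable {d : ℕ}

/-! ### 10a. The two-scale bond graph of a fine region F and a coarse region C [folklore] -/

/-- The BONDS of a two-scale model with an arbitrary FINE region F ⊆ ℤ^d (η-lattice points joined by η-bonds inside F)
and an arbitrary COARSE region C ⊆ ℤ^d (Lη-lattice points L·y, y ∈ C, joined by the Lη-bonds {L·y, L·y′}, y ∼ y′ in C);
§8a's `twoScaleRel` is the case F = {x_μ < M}, C = {0 ≤ y_μ} (`regionRel_flat`). [folklore] -/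
def regionRel (d L : ℕ) (F C : Set (Site d)) (u v : Site d) : Prop :=
  ((zdGraph d).Adj u v ∧ u ∈ F ∧ v ∈ F) ∨
    ∃ y y' : Site d, (zdGraph d).Adj y y' ∧ y ∈ C ∧ y' ∈ C ∧ u = scalePt L y ∧ v = scalePt L y'

/-- The two-scale bond graph of the regions F (fine) and C (coarse). [folklore] -/
def regionGraph (d L : ℕ) (F C : Set (Site d)) : SimpleGraph (Site d) := SimpleGraph.fromRel (regionRel d L F C)

/-- Its point set: F ∪ L·C. [folklore] -/
def regionPts (d L : ℕ) (F C : Set (Site d)) : Set (Site d) := F ∪ {u | ∃ y : Site d, y ∈ C ∧ u = scalePt L y}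

/-- The flat model of §8a is the case F = {x_μ < M}, C = {0 ≤ y_μ}. [folklore] -/
theorem regionRel_flat (d L M : ℕ) (μ : Fin d) :
    regionRel d L {x : Site d | x μ < M} {y : Site d | 0 ≤ y μ} = twoScaleRel d L M μ := rfl

/-- … and so is its graph. [folklore] -/
theorem regionGraph_flat (d L M : ℕ) (μ : Fin d) :
    regionGraph d L {x : Site d | x μ < M} {y : Site d | 0 ≤ y μ} = twoScaleGraph d L M μ := rfl

/-- … and its point set. [folklore] -/
theorem regionPts_flat (d L M : ℕ) (μ : Fin d) :
    regionPts d L {x : Site d | x μ < M} {y : Site d | 0 ≤ y μ} = twoScalePts d L M μ := rfl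

variable {L : ℕ} {F C : Set (Site d)}

/-- Fine bonds are bonds. [folklore] -/
theorem regionGraph_adj_of_fine {u v : Site d} (h : (zdGraph d).Adj u v) (hu : u ∈ F) (hv : v ∈ F) :
    (regionGraph d L F C).Adj u v := by
  rw [regionGraph, SimpleGraph.fromRel_adj]
  exact ⟨h.ne, Or.inl (Or.inl ⟨h, hu, hv⟩)⟩

/-- Coarse bonds are bonds (L ≥ 1). [folklore] -/
theorem regionGraph_adj_of_coarse (hL : 0 < L) {y y' : Site d} (h : (zdGraph d).Adj y y') (hy : y ∈ C)
    (hy' : y' ∈ C) : (regionGraph d L F C).Adj (scalePt L y) (scalePt L y') := by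
  rw [regionGraph, SimpleGraph.fromRel_adj]
  exact ⟨fun he => h.ne (scalePt_injective hL he), Or.inl (Or.inr ⟨y, y', h, hy, hy', rfl, rfl⟩)⟩

/-- Both ends of a bond are points of F ∪ L·C. [folklore] -/
theorem mem_regionPts_of_rel {u v : Site d} (h : regionRel d L F C u v) :
    u ∈ regionPts d L F C ∧ v ∈ regionPts d L F C := by
  rcases h with ⟨-, hu, hv⟩ | ⟨y, y', -, hy, hy', rfl, rfl⟩
  · exact ⟨Or.inl hu, Or.inl hv⟩
  · exact ⟨Or.inr ⟨y, hy, rfl⟩, Or.inr ⟨y', hy', rfl⟩⟩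

/-- HONESTY: points outside F ∪ L·C are isolated. [folklore] -/
theorem regionGraph_not_adj_of_not_mem {u : Site d} (hu : u ∉ regionPts d L F C) (v : Site d) :
    ¬ (regionGraph d L F C).Adj u v := by
  rw [regionGraph, SimpleGraph.fromRel_adj]
  rintro ⟨-, h | h⟩
  · exact hu (mem_regionPts_of_rel h).1
  · exact hu (mem_regionPts_of_rel h).2

/-- A coordinate-box closed part of the fine region is a chart (identity chart map). [folklore] -/
theorem isBoxChart_region_fine {B : Set (Site d)} (hB : CboxClosed B) (hBF : B ⊆ F) :
    IsBoxChart (regionGraph d L F C) B (fun x => x) :=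
  ⟨hB, fun _ _ hu hv h => regionGraph_adj_of_fine h (hBF hu) (hBF hv)⟩

/-- A coordinate-box closed part of the coarse region is a chart (chart map y ↦ L·y, L ≥ 1). [folklore] -/
theorem isBoxChart_region_coarse (hL : 0 < L) {B : Set (Site d)} (hB : CboxClosed B) (hBC : B ⊆ C) :
    IsBoxChart (regionGraph d L F C) B (scalePt L) :=
  ⟨hB, fun _ _ hy hy' h => regionGraph_adj_of_coarse hL h (hBC hy) (hBC hy')⟩

/-! ### 10b. Two ℓ¹ book-keeping identities [folklore] -/

/-- Moving one coordinate first: for w := u with u_i replaced by v_i, ‖u − w‖₁ + ‖w − v‖₁ = ‖u − v‖₁. [folklore] -/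
theorem latL1Dist_update_split (u v : Site d) (i : Fin d) :
    latL1Dist u (Function.update u i (v i)) + latL1Dist (Function.update u i (v i)) v = latL1Dist u v := by
  unfold latL1Dist
  rw [← Finset.sum_add_distrib]
  refine Finset.sum_congr rfl fun j _ => ?_
  by_cases hj : j = i
  · subst hj; rw [Function.update_self]; simp
  · rw [Function.update_of_ne hj]; simp

/-- Rounding ONE coordinate down to the coarse lattice (the arithmetic of §8e's slab route, extracted): for
z := y with y_μ replaced by ⌊u_μ/L⌋, ‖u − L·z‖₁ + ‖z − y‖₁ ≤ ‖u − L·y‖₁ + (L − 1) (L ≥ 1; no sign conditions). [folklore] -/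
theorem latL1Dist_round_le (hL : 1 ≤ L) (u y : Site d) (μ : Fin d) :
    latL1Dist u (scalePt L (Function.update y μ (u μ / L))) + latL1Dist (Function.update y μ (u μ / L)) y ≤
      latL1Dist u (scalePt L y) + (L - 1) := by
  have hL0 : (0 : ℤ) < L := by exact_mod_cast hL
  have hsplit : latL1Dist u (scalePt L y) + (L - 1) =
      ∑ i : Fin d, ((u i - scalePt L y i).natAbs + if i = μ then L - 1 else 0) := by
    rw [Finset.sum_add_distrib, Finset.sum_ite_eq' Finset.univ μ, if_pos (Finset.mem_univ μ)]; rfl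
  rw [hsplit]
  unfold latL1Dist
  rw [← Finset.sum_add_distrib]
  refine Finset.sum_le_sum fun i _ => ?_
  rw [scalePt_apply, scalePt_apply]
  by_cases hi : i = μ
  · subst hi
    rw [if_pos rfl, Function.update_self]
    have hq := natAbs_ediv_sub_le hL0 (u i) (y i)
    have hdiv := Int.mul_ediv_add_emod (u i) L
    have hr0 := Int.emod_nonneg (u i) hL0.ne'
    have hrL := Int.emod_lt_of_pos (u i) hL0
    have hrem : (u i - (L : ℤ) * (u i / L)).natAbs ≤ L - 1 := by
      have : u i - (L : ℤ) * (u i / L) = u i % L := by omega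
      rw [this]; omega
    omega
  · rw [if_neg hi, Function.update_of_ne hi]
    simp


/-! ### 10c. The SALIENT corner: coarse orthant ⋂_{i∈I} {0 ≤ y_i}, fine union ⋃_{i∈I} {x_i < M} — the flat constant
survives [folklore] -/

/-- Fine region of the SALIENT corner model: the η-lattice points with SOME coordinate x_i < M, i ∈ I (the complement
of the coarse orthant Ω₁ = ⋂_{i∈I}{x_i ≥ 0}, thickened by the overlap slab of one fine block). [folklore] -/
def salientFine (d M : ℕ) (I : Finset (Fin d)) : Set (Site d) := {x | ∃ i ∈ I, x i < M}

/-- Coarse region of the salient corner model: the Lη-lattice points L·y with y in the orthant ⋂_{i∈I}{0 ≤ y_i}.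
[folklore] -/
def salientCoarse (d : ℕ) (I : Finset (Fin d)) : Set (Site d) := {y | ∀ i ∈ I, 0 ≤ y i}

/-- The salient corner bond graph (I = {μ}: the flat model of §8a). [folklore] -/
def salientGraph (d L M : ℕ) (I : Finset (Fin d)) : SimpleGraph (Site d) :=
  regionGraph d L (salientFine d M I) (salientCoarse d I)

/-- Its point set. [folklore] -/
def salientPts (d L M : ℕ) (I : Finset (Fin d)) : Set (Site d) := regionPts d L (salientFine d M I) (salientCoarse d I)

/-- One salient direction I = {μ} is the flat model of §8a. [folklore] -/
theorem salientGraph_singleton (d L M : ℕ) (μ : Fin d) : salientGraph d L M {μ} = twoScaleGraph d L M μ := by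
  simp only [salientGraph, salientFine, salientCoarse, Finset.mem_singleton, exists_eq_left, forall_eq]
  rfl

/-- … with the same point set. [folklore] -/
theorem salientPts_singleton (d L M : ℕ) (μ : Fin d) : salientPts d L M {μ} = twoScalePts d L M μ := by
  simp only [salientPts, salientFine, salientCoarse, Finset.mem_singleton, exists_eq_left, forall_eq]
  rfl

variable {M : ℕ} {I : Finset (Fin d)}

/-- The coarse orthant is coordinate-box closed. [folklore] -/
theorem cboxClosed_salientCoarse : CboxClosed (salientCoarse d I) := by
  intro u y hu hy z hz i hi
  exact (le_min (hu i hi) (hy i hi)).trans (hz i).1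

/-- Each half-space {x_i < M}, i ∈ I, lies in the salient fine region. [folklore] -/
theorem halfspace_subset_salientFine {i : Fin d} (hi : i ∈ I) : {x : Site d | x i < M} ⊆ salientFine d M I :=
  fun _ hx => ⟨i, hi, hx⟩

/-- Coarse–coarse in the salient corner: one chart (the orthant), d(L·y, L·y′) ≤ ‖y − y′‖₁ (Lη-units). [folklore] -/
theorem salient_coarse (hL : 0 < L) {y y' : Site d} (hy : y ∈ salientCoarse d I) (hy' : y' ∈ salientCoarse d I) :
    (salientGraph d L M I).Reachable (scalePt L y) (scalePt L y') ∧
      (salientGraph d L M I).dist (scalePt L y) (scalePt L y') ≤ latL1Dist y y' :=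
  have hch := isBoxChart_region_coarse (F := salientFine d M I) hL (cboxClosed_salientCoarse (I := I)) (fun _ h => h)
  ⟨reachable_of_chart hch hy hy', dist_le_latL1Dist_of_chart hch hy hy'⟩

/-- Fine–fine in the salient corner: the fine region is a UNION of half-space charts; moving the coordinate i₂ first
(w := u with u_{i₂} := v_{i₂} lies in both half-spaces), d(u, v) ≤ ‖u − w‖₁ + ‖w − v‖₁ = ‖u − v‖₁ — no loss around a
salient corner. [folklore] -/
theorem salient_fine {u v : Site d} (hu : u ∈ salientFine d M I) (hv : v ∈ salientFine d M I) :
    (salientGraph d L M I).Reachable u v ∧ (salientGraph d L M I).dist u v ≤ latL1Dist u v := by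
  obtain ⟨i₁, hi₁, hu1⟩ := hu
  obtain ⟨i₂, hi₂, hv2⟩ := hv
  have hw2 : Function.update u i₂ (v i₂) i₂ < M := by rw [Function.update_self]; exact hv2
  have hw1 : Function.update u i₂ (v i₂) i₁ < M := by
    by_cases h : i₁ = i₂
    · rw [h]; exact hw2
    · rw [Function.update_of_ne h]; exact hu1
  have hch1 := isBoxChart_region_fine (L := L) (C := salientCoarse d I) (cboxClosed_setOf_apply_lt i₁ (M : ℤ))
    (halfspace_subset_salientFine (M := M) hi₁)
  have hch2 := isBoxChart_region_fine (L := L) (C := salientCoarse d I) (cboxClosed_setOf_apply_lt i₂ (M : ℤ))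
    (halfspace_subset_salientFine (M := M) hi₂)
  have hr1 : (salientGraph d L M I).Reachable u (Function.update u i₂ (v i₂)) := reachable_of_chart hch1 hu1 hw1
  have h1 : (salientGraph d L M I).dist u (Function.update u i₂ (v i₂)) ≤ latL1Dist u (Function.update u i₂ (v i₂)) :=
    dist_le_latL1Dist_of_chart hch1 hu1 hw1
  have hr2 : (salientGraph d L M I).Reachable (Function.update u i₂ (v i₂)) v := reachable_of_chart hch2 hw2 hv2
  have h2 : (salientGraph d L M I).dist (Function.update u i₂ (v i₂)) v ≤ latL1Dist (Function.update u i₂ (v i₂)) v :=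
    dist_le_latL1Dist_of_chart hch2 hw2 hv2
  have h3 := hr1.dist_triangle_left (G := salientGraph d L M I) v
  have h4 := latL1Dist_update_split u v i₂
  exact ⟨hr1.trans hr2, by omega⟩

/-- Fine–coarse in the salient corner: constant 1 plus at most ONE rounding, d(u, L·y) ≤ ‖u − L·y‖₁ + (L − 1) — through
the foot y₀ := y with y_{i₁} := 0 when u_{i₁} ≤ 0 (`latL1Dist_foot_le`, no additive term), through the rounded point
z := y with y_{i₁} := ⌊u_{i₁}/L⌋ when 0 < u_{i₁} < M (`latL1Dist_round_le`); the other coordinates move freely by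
fine bonds because ONE small coordinate keeps a point fine (M, L ≥ 1). [folklore] -/
theorem salient_fine_coarse (hM : 0 < M) (hL : 1 ≤ L) {u y : Site d} (hu : u ∈ salientFine d M I)
    (hy : y ∈ salientCoarse d I) :
    (salientGraph d L M I).Reachable u (scalePt L y) ∧
      (salientGraph d L M I).dist u (scalePt L y) ≤ latL1Dist u (scalePt L y) + (L - 1) := by
  have hL0 : (0 : ℤ) < L := by exact_mod_cast hL
  obtain ⟨i₁, hi₁, hu1⟩ := hu
  have hchF := isBoxChart_region_fine (L := L) (C := salientCoarse d I) (cboxClosed_setOf_apply_lt i₁ (M : ℤ))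
    (halfspace_subset_salientFine (M := M) hi₁)
  -- the intermediate coarse point: foot (u_{i₁} ≤ 0) or rounding (0 < u_{i₁})
  have key : ∀ c : ℤ, 0 ≤ c → (L : ℤ) * c < M →
      latL1Dist u (scalePt L (Function.update y i₁ c)) + latL1Dist (Function.update y i₁ c) y ≤
        latL1Dist u (scalePt L y) + (L - 1) →
      (salientGraph d L M I).Reachable u (scalePt L y) ∧
        (salientGraph d L M I).dist u (scalePt L y) ≤ latL1Dist u (scalePt L y) + (L - 1) := by
    intro c hc hcM h4
    have hz : Function.update y i₁ c ∈ salientCoarse d I := by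
      intro i hi
      by_cases h : i = i₁
      · rw [h, Function.update_self]; exact hc
      · rw [Function.update_of_ne h]; exact hy i hi
    have hLz : scalePt L (Function.update y i₁ c) i₁ < M := by rw [scalePt_apply, Function.update_self]; exact hcM
    have hr1 : (salientGraph d L M I).Reachable u (scalePt L (Function.update y i₁ c)) := reachable_of_chart hchF hu1 hLz
    have h1 : (salientGraph d L M I).dist u (scalePt L (Function.update y i₁ c)) ≤
        latL1Dist u (scalePt L (Function.update y i₁ c)) := dist_le_latL1Dist_of_chart hchF hu1 hLz
    obtain ⟨hr2, h2⟩ := salient_coarse (M := M) (by omega : 0 < L) hz hy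
    have h3 := hr1.dist_triangle_left (G := salientGraph d L M I) (scalePt L y)
    exact ⟨hr1.trans hr2, by omega⟩
  rcases le_or_gt (u i₁) 0 with h0 | h0
  · refine key 0 le_rfl (by rw [mul_zero]; exact_mod_cast hM) ?_
    exact (latL1Dist_foot_le hL h0 (hy i₁ hi₁)).trans (Nat.le_add_right _ _)
  · exact key (u i₁ / L) (Int.ediv_nonneg h0.le hL0.le) ((Int.mul_ediv_self_le hL0.ne').trans_lt hu1)
      (latL1Dist_round_le hL u y i₁)

/-- **The salient corner keeps the flat constants**: for all points u, v of the salient corner model (M, L ≥ 1),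
u and v are joined by an admissible walk and `dist u v ≤ ‖u − v‖₁ + (L − 1)` in η-units — the comparison of §8e item 8,
unchanged by a salient (convex-coarse) corner of Σ with any number |I| ≤ d of faces. [folklore] -/
theorem salient_reachable_dist (hM : 0 < M) (hL : 1 ≤ L) {u v : Site d} (hu : u ∈ salientPts d L M I)
    (hv : v ∈ salientPts d L M I) :
    (salientGraph d L M I).Reachable u v ∧ (salientGraph d L M I).dist u v ≤ latL1Dist u v + (L - 1) := by
  rcases hu with hu | ⟨y, hy, rfl⟩ <;> rcases hv with hv | ⟨y', hy', rfl⟩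
  · obtain ⟨hr, h⟩ := salient_fine (L := L) hu hv
    exact ⟨hr, h.trans (Nat.le_add_right _ _)⟩
  · exact salient_fine_coarse hM hL hu hy'
  · obtain ⟨hr, h⟩ := salient_fine_coarse hM hL hv hy
    rw [SimpleGraph.dist_comm, latL1Dist_comm] at h
    exact ⟨hr.symm, h⟩
  · obtain ⟨hr, h⟩ := salient_coarse (M := M) (by omega : 0 < L) hy hy'
    refine ⟨hr, h.trans ?_⟩
    rw [latL1Dist_scalePt]
    have : latL1Dist y y' ≤ L * latL1Dist y y' := Nat.le_mul_of_pos_left _ (by omega)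
    omega

/-- The (2.66)-shaped exponential form at a salient corner: e^{−δ‖u − v‖₁} ≤ e^{δ(L − 1)}·e^{−δ·dist(u,v)} on the salient
point set (δ ≥ 0; M, L ≥ 1) — the flat factor of `twoScale_exp_decay_le`. [folklore] -/
theorem salient_exp_decay_le (hM : 0 < M) (hL : 1 ≤ L) {δ : ℝ} (hδ : 0 ≤ δ) {u v : Site d}
    (hu : u ∈ salientPts d L M I) (hv : v ∈ salientPts d L M I) :
    Real.exp (-(δ * latL1Dist u v)) ≤
      Real.exp (δ * ((L : ℝ) - 1)) * Real.exp (-(δ * (salientGraph d L M I).dist u v)) := by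
  have h := (salient_reachable_dist hM hL hu hv).2
  have h' : ((salientGraph d L M I).dist u v : ℝ) ≤ 1 * (latL1Dist u v : ℝ) + ((L : ℝ) - 1) := by
    have hL1 : ((L - 1 : ℕ) : ℝ) = (L : ℝ) - 1 := by rw [Nat.cast_sub hL, Nat.cast_one]
    rw [one_mul, ← hL1]
    exact_mod_cast h
  simpa using exp_decay_transfer hδ one_pos h'

/-! ### 10d. The RE-ENTRANT corner: coarse union ⋃_{i∈I} {0 ≤ y_i}, fine intersection ⋂_{i∈I} {x_i < M} — one rounding
per re-entrant direction [folklore] -/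

/-- Fine region of the RE-ENTRANT corner model: the η-lattice points with ALL coordinates x_i < M, i ∈ I (the pocket
outside the coarse region Ω₁ = ⋃_{i∈I}{x_i ≥ 0}, thickened by the overlap slab). [folklore] -/
def reentrantFine (d M : ℕ) (I : Finset (Fin d)) : Set (Site d) := {x | ∀ i ∈ I, x i < M}

/-- Coarse region of the re-entrant corner model: L·y with SOME coordinate y_i ≥ 0, i ∈ I (a union of half-lattices).
[folklore] -/
def reentrantCoarse (d : ℕ) (I : Finset (Fin d)) : Set (Site d) := {y | ∃ i ∈ I, 0 ≤ y i}

/-- The re-entrant corner bond graph (I = {μ}: the flat model of §8a). [folklore] -/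
def reentrantGraph (d L M : ℕ) (I : Finset (Fin d)) : SimpleGraph (Site d) :=
  regionGraph d L (reentrantFine d M I) (reentrantCoarse d I)

/-- Its point set. [folklore] -/
def reentrantPts (d L M : ℕ) (I : Finset (Fin d)) : Set (Site d) :=
  regionPts d L (reentrantFine d M I) (reentrantCoarse d I)

/-- One re-entrant direction I = {μ} is the flat model of §8a, too. [folklore] -/
theorem reentrantGraph_singleton (d L M : ℕ) (μ : Fin d) : reentrantGraph d L M {μ} = twoScaleGraph d L M μ := by
  simp only [reentrantGraph, reentrantFine, reentrantCoarse, Finset.mem_singleton, exists_eq_left, forall_eq]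
  rfl

/-- … with the same point set. [folklore] -/
theorem reentrantPts_singleton (d L M : ℕ) (μ : Fin d) : reentrantPts d L M {μ} = twoScalePts d L M μ := by
  simp only [reentrantPts, reentrantFine, reentrantCoarse, Finset.mem_singleton, exists_eq_left, forall_eq]
  rfl

/-- The fine pocket is coordinate-box closed. [folklore] -/
theorem cboxClosed_reentrantFine : CboxClosed (reentrantFine d M I) := by
  intro u y hu hy z hz i hi
  exact (hz i).2.trans_lt (max_lt (hu i hi) (hy i hi))

/-- Fine–fine in the re-entrant corner: one chart, d(u, v) ≤ ‖u − v‖₁. [folklore] -/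
theorem reentrant_fine {u v : Site d} (hu : u ∈ reentrantFine d M I) (hv : v ∈ reentrantFine d M I) :
    (reentrantGraph d L M I).Reachable u v ∧ (reentrantGraph d L M I).dist u v ≤ latL1Dist u v :=
  have hch := isBoxChart_region_fine (L := L) (C := reentrantCoarse d I) (cboxClosed_reentrantFine (M := M) (I := I))
    (fun _ h => h)
  ⟨reachable_of_chart hch hu hv, dist_le_latL1Dist_of_chart hch hu hv⟩

/-- Coarse–coarse in the re-entrant corner: the coarse region is a UNION of half-lattice charts; moving the coordinate
i₂ first (w := y with y_{i₂} := y′_{i₂} lies in both half-lattices), d(L·y, L·y′) ≤ ‖y − y′‖₁. [folklore] -/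
theorem reentrant_coarse (hL : 0 < L) {y y' : Site d} (hy : y ∈ reentrantCoarse d I) (hy' : y' ∈ reentrantCoarse d I) :
    (reentrantGraph d L M I).Reachable (scalePt L y) (scalePt L y') ∧
      (reentrantGraph d L M I).dist (scalePt L y) (scalePt L y') ≤ latL1Dist y y' := by
  obtain ⟨i₁, hi₁, hy1⟩ := hy
  obtain ⟨i₂, hi₂, hy2⟩ := hy'
  have hw2 : 0 ≤ Function.update y i₂ (y' i₂) i₂ := by rw [Function.update_self]; exact hy2
  have hw1 : 0 ≤ Function.update y i₂ (y' i₂) i₁ := by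
    by_cases h : i₁ = i₂
    · rw [h]; exact hw2
    · rw [Function.update_of_ne h]; exact hy1
  have hch1 := isBoxChart_region_coarse (F := reentrantFine d M I) hL (cboxClosed_setOf_le_apply i₁ (0 : ℤ))
    (fun x (hx : 0 ≤ x i₁) => (⟨i₁, hi₁, hx⟩ : x ∈ reentrantCoarse d I))
  have hch2 := isBoxChart_region_coarse (F := reentrantFine d M I) hL (cboxClosed_setOf_le_apply i₂ (0 : ℤ))
    (fun x (hx : 0 ≤ x i₂) => (⟨i₂, hi₂, hx⟩ : x ∈ reentrantCoarse d I))
  have hr1 : (reentrantGraph d L M I).Reachable (scalePt L y) (scalePt L (Function.update y i₂ (y' i₂))) :=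
    reachable_of_chart hch1 hy1 hw1
  have h1 : (reentrantGraph d L M I).dist (scalePt L y) (scalePt L (Function.update y i₂ (y' i₂))) ≤
      latL1Dist y (Function.update y i₂ (y' i₂)) := dist_le_latL1Dist_of_chart hch1 hy1 hw1
  have hr2 : (reentrantGraph d L M I).Reachable (scalePt L (Function.update y i₂ (y' i₂))) (scalePt L y') :=
    reachable_of_chart hch2 hw2 hy2
  have h2 : (reentrantGraph d L M I).dist (scalePt L (Function.update y i₂ (y' i₂))) (scalePt L y') ≤
      latL1Dist (Function.update y i₂ (y' i₂)) y' := dist_le_latL1Dist_of_chart hch2 hw2 hy2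
  have h3 := hr1.dist_triangle_left (G := reentrantGraph d L M I) (scalePt L y')
  have h4 := latL1Dist_update_split y y' i₂
  exact ⟨hr1.trans hr2, by omega⟩

/-- The intermediate coarse index of the re-entrant route from a fine point u to L·y (y_{i₀} ≥ 0, i₀ ∈ I): every
coordinate i ∈ I of u is rounded DOWN to the coarse lattice, ⌊u_i/L⌋, except that u_{i₀} < 0 is moved UP to 0 (so that
the index has a nonnegative coordinate in I); the coordinates outside I are those of y. [folklore] -/
def cornerFoot (L : ℕ) (I : Finset (Fin d)) (i₀ : Fin d) (u y : Site d) : Site d :=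
  fun i => if i = i₀ then max (u i / L) 0 else if i ∈ I then u i / L else y i

/-- The intermediate index is coarse (its i₀-coordinate is ≥ 0). [folklore] -/
theorem cornerFoot_mem_coarse {i₀ : Fin d} (hi₀ : i₀ ∈ I) (u y : Site d) :
    cornerFoot L I i₀ u y ∈ reentrantCoarse d I :=
  ⟨i₀, hi₀, by simp only [cornerFoot]; exact le_max_right _ _⟩

/-- L·(the intermediate index) is a fine point: each rounded coordinate is ≤ u_i < M, the lifted one is 0 < M
(M, L ≥ 1). [folklore] -/
theorem scalePt_cornerFoot_mem_fine (hM : 0 < M) (hL : 1 ≤ L) {i₀ : Fin d} {u : Site d}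
    (hu : u ∈ reentrantFine d M I) (y : Site d) : scalePt L (cornerFoot L I i₀ u y) ∈ reentrantFine d M I := by
  have hL0 : (0 : ℤ) < L := by exact_mod_cast hL
  intro i hi
  rw [scalePt_apply]
  simp only [cornerFoot]
  split_ifs with h1
  · rcases le_or_gt 0 (u i / L) with hq | hq
    · rw [max_eq_left hq]; exact (Int.mul_ediv_self_le hL0.ne').trans_lt (hu i hi)
    · rw [max_eq_right hq.le, mul_zero]; exact_mod_cast hM
  · exact (Int.mul_ediv_self_le hL0.ne').trans_lt (hu i hi)

/-- The arithmetic of the re-entrant route: ‖u − L·z‖₁ + ‖z − y‖₁ ≤ ‖u − L·y‖₁ + |I|·(L − 1) for the intermediate index z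
(per coordinate i ∈ I one rounding, cost ≤ L − 1 by `natAbs_ediv_sub_le`; the lifted coordinate costs nothing because
y_{i₀} ≥ 0; the coordinates outside I are exact). [folklore] -/
theorem latL1Dist_cornerFoot_le (hL : 1 ≤ L) {i₀ : Fin d} (hi₀ : i₀ ∈ I) (u : Site d) {y : Site d} (hy0 : 0 ≤ y i₀) :
    latL1Dist u (scalePt L (cornerFoot L I i₀ u y)) + latL1Dist (cornerFoot L I i₀ u y) y ≤
      latL1Dist u (scalePt L y) + I.card * (L - 1) := by
  have hL0 : (0 : ℤ) < L := by exact_mod_cast hL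
  have hL1 : (1 : ℤ) ≤ L := by exact_mod_cast hL
  have hsplit : latL1Dist u (scalePt L y) + I.card * (L - 1) =
      ∑ i : Fin d, ((u i - scalePt L y i).natAbs + if i ∈ I then L - 1 else 0) := by
    rw [Finset.sum_add_distrib, Finset.sum_ite_mem, Finset.univ_inter, Finset.sum_const, smul_eq_mul]; rfl
  rw [hsplit]
  unfold latL1Dist
  rw [← Finset.sum_add_distrib]
  refine Finset.sum_le_sum fun i _ => ?_
  rw [scalePt_apply, scalePt_apply]
  simp only [cornerFoot]
  have hq := natAbs_ediv_sub_le hL0 (u i) (y i)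
  have hdiv := Int.mul_ediv_add_emod (u i) L
  have hr0 := Int.emod_nonneg (u i) hL0.ne'
  have hrL := Int.emod_lt_of_pos (u i) hL0
  have hrem : (u i - (L : ℤ) * (u i / L)).natAbs ≤ L - 1 := by
    have : u i - (L : ℤ) * (u i / L) = u i % L := by omega
    rw [this]; omega
  by_cases h1 : i = i₀
  · have hy0' : 0 ≤ y i := by rw [h1]; exact hy0
    have hiI : i ∈ I := by rw [h1]; exact hi₀
    rw [if_pos h1, if_pos hiI]
    rcases le_or_gt 0 (u i / L) with hq0 | hq0
    · rw [max_eq_left hq0]; omega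
    · rw [max_eq_right hq0.le, mul_zero]
      have hu0 : u i < 0 := by
        by_contra hc
        exact absurd (Int.ediv_nonneg (not_lt.1 hc) hL0.le) (not_le.2 hq0)
      have h5 : y i ≤ (L : ℤ) * y i := by nlinarith
      omega
  · rw [if_neg h1]
    by_cases h2 : i ∈ I
    · rw [if_pos h2, if_pos h2]; omega
    · rw [if_neg h2, if_neg h2]; simp

/-- Fine–coarse in the re-entrant corner: d(u, L·y) ≤ ‖u − L·y‖₁ + |I|·(L − 1) — fine bonds inside the pocket from u to
L·z (z the intermediate index), then coarse bonds from L·z to L·y (M, L ≥ 1). [folklore] -/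
theorem reentrant_fine_coarse (hM : 0 < M) (hL : 1 ≤ L) {u y : Site d} (hu : u ∈ reentrantFine d M I)
    (hy : y ∈ reentrantCoarse d I) :
    (reentrantGraph d L M I).Reachable u (scalePt L y) ∧
      (reentrantGraph d L M I).dist u (scalePt L y) ≤ latL1Dist u (scalePt L y) + I.card * (L - 1) := by
  obtain ⟨i₀, hi₀, hy0⟩ := hy
  have hchF := isBoxChart_region_fine (L := L) (C := reentrantCoarse d I) (cboxClosed_reentrantFine (M := M) (I := I))
    (fun _ h => h)
  have hzC := cornerFoot_mem_coarse (L := L) hi₀ u y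
  have hzF := scalePt_cornerFoot_mem_fine (i₀ := i₀) hM hL hu y
  have hr1 : (reentrantGraph d L M I).Reachable u (scalePt L (cornerFoot L I i₀ u y)) := reachable_of_chart hchF hu hzF
  have h1 : (reentrantGraph d L M I).dist u (scalePt L (cornerFoot L I i₀ u y)) ≤
      latL1Dist u (scalePt L (cornerFoot L I i₀ u y)) := dist_le_latL1Dist_of_chart hchF hu hzF
  obtain ⟨hr2, h2⟩ := reentrant_coarse (M := M) (by omega : 0 < L) hzC ⟨i₀, hi₀, hy0⟩
  have h3 := hr1.dist_triangle_left (G := reentrantGraph d L M I) (scalePt L y)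
  have h4 := latL1Dist_cornerFoot_le hL hi₀ u hy0
  exact ⟨hr1.trans hr2, by omega⟩

/-- **The re-entrant corner costs one rounding per re-entrant direction**: for all points u, v of the re-entrant
corner model with |I| = m constrained directions (M, L ≥ 1), u and v are joined by an admissible walk and
`dist u v ≤ ‖u − v‖₁ + m·(L − 1)` in η-units; m ≤ d, so the additive constant depends on d and L only and not on M —
the dependence p. 247 prints for the O(1) of Prop. 2.6.  Sharp: `reentrant_dist_cornerWitness`. [folklore] -/
theorem reentrant_reachable_dist (hM : 0 < M) (hL : 1 ≤ L) {u v : Site d} (hu : u ∈ reentrantPts d L M I)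
    (hv : v ∈ reentrantPts d L M I) :
    (reentrantGraph d L M I).Reachable u v ∧ (reentrantGraph d L M I).dist u v ≤ latL1Dist u v + I.card * (L - 1) := by
  rcases hu with hu | ⟨y, hy, rfl⟩ <;> rcases hv with hv | ⟨y', hy', rfl⟩
  · obtain ⟨hr, h⟩ := reentrant_fine (L := L) hu hv
    exact ⟨hr, h.trans (Nat.le_add_right _ _)⟩
  · exact reentrant_fine_coarse hM hL hu hy'
  · obtain ⟨hr, h⟩ := reentrant_fine_coarse hM hL hv hy
    rw [SimpleGraph.dist_comm, latL1Dist_comm] at h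
    exact ⟨hr.symm, h⟩
  · obtain ⟨hr, h⟩ := reentrant_coarse (M := M) (by omega : 0 < L) hy hy'
    refine ⟨hr, h.trans ?_⟩
    rw [latL1Dist_scalePt]
    have : latL1Dist y y' ≤ L * latL1Dist y y' := Nat.le_mul_of_pos_left _ (by omega)
    omega

/-- The (2.66)-shaped exponential form at a re-entrant corner: e^{−δ‖u − v‖₁} ≤ e^{δ·m(L − 1)}·e^{−δ·dist(u,v)} on the
re-entrant point set, m = |I| (δ ≥ 0; M, L ≥ 1) — constant depending on d, L (and δ) only. [folklore] -/
theorem reentrant_exp_decay_le (hM : 0 < M) (hL : 1 ≤ L) {δ : ℝ} (hδ : 0 ≤ δ) {u v : Site d}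
    (hu : u ∈ reentrantPts d L M I) (hv : v ∈ reentrantPts d L M I) :
    Real.exp (-(δ * latL1Dist u v)) ≤
      Real.exp (δ * (I.card * ((L : ℝ) - 1))) * Real.exp (-(δ * (reentrantGraph d L M I).dist u v)) := by
  have h := (reentrant_reachable_dist hM hL hu hv).2
  have h' : ((reentrantGraph d L M I).dist u v : ℝ) ≤ 1 * (latL1Dist u v : ℝ) + (I.card * ((L : ℝ) - 1)) := by
    have hL1 : ((I.card * (L - 1) : ℕ) : ℝ) = I.card * ((L : ℝ) - 1) := by
      rw [Nat.cast_mul, Nat.cast_sub hL, Nat.cast_one]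
    rw [one_mul, ← hL1]
    exact_mod_cast h
  simpa using exp_decay_transfer hδ one_pos h'

/-! ### 10e. SHARPNESS at the re-entrant corner: a potential with one unit of slack per coordinate [folklore] -/

/-- The one-coordinate potential: 0 below M − L, rising with slope 1 from 1 at M − L to L at M − 1, and 0 from M on.
For M ∈ L·ℕ it takes values ≤ 1 on the coarse lattice L·ℤ, so coarse bonds (which jump by L) change it by ≤ 1, while fine
bonds (unit steps below M) change it by ≤ 1 — but it drops by L between the fine point M − 1 and the coarse point M,
which are NOT joined by a bond. [folklore] -/
def cornerPot (M L : ℕ) (t : ℤ) : ℕ := if (M : ℤ) - L ≤ t ∧ t < M then (t - ((M : ℤ) - L) + 1).toNat else 0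

/-- Unit steps below M change the potential by at most 1. [folklore] -/
theorem cornerPot_step {M L : ℕ} {t : ℤ} (ht : t + 1 < M) :
    cornerPot M L t ≤ cornerPot M L (t + 1) + 1 ∧ cornerPot M L (t + 1) ≤ cornerPot M L t + 1 := by
  unfold cornerPot
  split_ifs <;> omega

/-- On the coarse lattice L·ℤ the potential is ≤ 1 (M ∈ L·ℕ, L ≥ 1). [folklore] -/
theorem cornerPot_mul_le_one {M L M' : ℕ} (hL : 1 ≤ L) (hM : M = L * M') (k : ℤ) : cornerPot M L (L * k) ≤ 1 := by
  unfold cornerPot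
  split_ifs with h
  · obtain ⟨-, h2⟩ := h
    have hL0 : (0 : ℤ) < L := by exact_mod_cast hL
    have hMM : (M : ℤ) = (L : ℤ) * M' := by rw [hM]; push_cast; ring
    have hk : k < M' := by
      by_contra hc
      have := mul_le_mul_of_nonneg_left (not_lt.1 hc) hL0.le
      omega
    have hk1 : (L : ℤ) * (k + 1) ≤ L * M' := mul_le_mul_of_nonneg_left (by omega) hL0.le
    rw [mul_add, mul_one] at hk1
    omega
  · exact Nat.zero_le _

/-- The potential of the fine point's coordinate M − 1 is L (1 ≤ L ≤ M). [folklore] -/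
theorem cornerPot_pred {M L : ℕ} (hL : 1 ≤ L) (hLM : L ≤ M) : cornerPot M L ((M : ℤ) - 1) = L := by
  have hLM' : (L : ℤ) ≤ M := by exact_mod_cast hLM
  have hL' : (1 : ℤ) ≤ L := by exact_mod_cast hL
  unfold cornerPot
  rw [if_pos ⟨by omega, by omega⟩]
  omega

/-- The potential vanishes at M. [folklore] -/
theorem cornerPot_self (M L : ℕ) : cornerPot M L M = 0 := by
  unfold cornerPot
  rw [if_neg fun h => lt_irrefl _ h.2]

/-- The corner potential: the sum of the one-coordinate potentials over the re-entrant directions. [folklore] -/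
def cornerPotential (I : Finset (Fin d)) (M L : ℕ) (x : Site d) : ℕ := ∑ i ∈ I, cornerPot M L (x i)

/-- Sums over I that agree off one coordinate j and differ by ≤ 1 at j differ by ≤ 1. [folklore] -/
theorem sum_le_sum_add_one {f g : Fin d → ℕ} (j : Fin d) (hne : ∀ i ∈ I, i ≠ j → f i ≤ g i)
    (hj : j ∈ I → f j ≤ g j + 1) : ∑ i ∈ I, f i ≤ (∑ i ∈ I, g i) + 1 := by
  calc ∑ i ∈ I, f i ≤ ∑ i ∈ I, (g i + if i = j then 1 else 0) := by
        refine Finset.sum_le_sum fun i hi => ?_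
        by_cases h : i = j
        · rw [if_pos h, h]; exact hj (h ▸ hi)
        · rw [if_neg h, add_zero]; exact hne i hi h
    _ = (∑ i ∈ I, g i) + ∑ i ∈ I, (if i = j then 1 else 0) := Finset.sum_add_distrib
    _ ≤ (∑ i ∈ I, g i) + 1 := by
        rw [Finset.sum_ite_eq']
        split_ifs <;> omega

/-- The corner potential is 1-Lipschitz along the bonds of the re-entrant model (M ∈ L·ℕ, L ≥ 1): a fine bond moves one
coordinate by 1 below M (`cornerPot_step`), a coarse bond moves one coordinate between two points of L·ℤ, where the
potential is ≤ 1 (`cornerPot_mul_le_one`). [folklore] -/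
theorem cornerPotential_le_of_rel {M M' : ℕ} (hL : 1 ≤ L) (hM : M = L * M') {u v : Site d}
    (h : regionRel d L (reentrantFine d M I) (reentrantCoarse d I) u v) :
    cornerPotential I M L u ≤ cornerPotential I M L v + 1 ∧
      cornerPotential I M L v ≤ cornerPotential I M L u + 1 := by
  -- two lattice points differing by e_j: coordinates
  have coords : ∀ {a b : Site d} {j : Fin d}, b = a + Pi.single j 1 →
      b j = a j + 1 ∧ ∀ i, i ≠ j → b i = a i := by
    intro a b j hb
    refine ⟨by rw [hb]; simp, fun i hi => by rw [hb]; simp [Pi.single_eq_of_ne hi]⟩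
  unfold cornerPotential
  rcases h with ⟨hadj, hu, hv⟩ | ⟨y, y', hadj, -, -, rfl, rfl⟩
  · -- fine bond: WLOG b = a + e_j with a, b ∈ the pocket
    have fine : ∀ {a b : Site d} {j : Fin d}, b = a + Pi.single j 1 → b ∈ reentrantFine d M I →
        ∑ i ∈ I, cornerPot M L (a i) ≤ (∑ i ∈ I, cornerPot M L (b i)) + 1 ∧
          ∑ i ∈ I, cornerPot M L (b i) ≤ (∑ i ∈ I, cornerPot M L (a i)) + 1 := by
      intro a b j hb hbF
      obtain ⟨hbj, hne⟩ := coords hb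
      have hst : ∀ hjI : j ∈ I, cornerPot M L (a j) ≤ cornerPot M L (a j + 1) + 1 ∧
          cornerPot M L (a j + 1) ≤ cornerPot M L (a j) + 1 :=
        fun hjI => cornerPot_step (by rw [← hbj]; exact hbF j hjI)
      constructor
      · exact sum_le_sum_add_one j (fun i _ hi => by rw [hne i hi]) (fun hjI => by rw [hbj]; exact (hst hjI).1)
      · exact sum_le_sum_add_one j (fun i _ hi => by rw [hne i hi]) (fun hjI => by rw [hbj]; exact (hst hjI).2)
    obtain ⟨j, hj | hj⟩ := (zdGraph_adj_iff u v).1 hadj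
    · exact fine hj hv
    · exact (fine hj hu).symm
  · -- coarse bond
    have coarse : ∀ {a b : Site d} {j : Fin d}, b = a + Pi.single j 1 →
        ∑ i ∈ I, cornerPot M L (scalePt L a i) ≤ (∑ i ∈ I, cornerPot M L (scalePt L b i)) + 1 ∧
          ∑ i ∈ I, cornerPot M L (scalePt L b i) ≤ (∑ i ∈ I, cornerPot M L (scalePt L a i)) + 1 := by
      intro a b j hb
      obtain ⟨-, hne⟩ := coords hb
      have hne' : ∀ i, i ≠ j → scalePt L b i = scalePt L a i := fun i hi => by rw [scalePt_apply, scalePt_apply, hne i hi]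
      have ha1 : cornerPot M L (scalePt L a j) ≤ 1 := by rw [scalePt_apply]; exact cornerPot_mul_le_one hL hM (a j)
      have hb1 : cornerPot M L (scalePt L b j) ≤ 1 := by rw [scalePt_apply]; exact cornerPot_mul_le_one hL hM (b j)
      constructor
      · exact sum_le_sum_add_one j (fun i _ hi => by rw [hne' i hi]) (fun _ => by omega)
      · exact sum_le_sum_add_one j (fun i _ hi => by rw [hne' i hi]) (fun _ => by omega)
    obtain ⟨j, hj | hj⟩ := (zdGraph_adj_iff y y').1 hadj
    · exact coarse hj
    · exact (coarse hj).symm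

/-- … hence along the bonds of the re-entrant graph. [folklore] -/
theorem cornerPotential_le_of_adj {M M' : ℕ} (hL : 1 ≤ L) (hM : M = L * M') {u v : Site d}
    (h : (reentrantGraph d L M I).Adj u v) : cornerPotential I M L u ≤ cornerPotential I M L v + 1 := by
  rw [reentrantGraph, regionGraph, SimpleGraph.fromRel_adj] at h
  rcases h.2 with h' | h'
  · exact (cornerPotential_le_of_rel hL hM h').1
  · exact (cornerPotential_le_of_rel hL hM h').2

/-- The fine corner point (M − 1)·𝟙_I of the witness. [folklore] -/
def cornerFinePt (I : Finset (Fin d)) (M : ℕ) : Site d := fun i => if i ∈ I then (M : ℤ) - 1 else 0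

/-- The coarse index M′·𝟙_I of the witness (its η-coordinates are M·𝟙_I when M = L·M′). [folklore] -/
def cornerCoarseIdx (I : Finset (Fin d)) (M' : ℕ) : Site d := fun i => if i ∈ I then (M' : ℤ) else 0

/-- (M − 1)·𝟙_I is a fine point. [folklore] -/
theorem cornerFinePt_mem : cornerFinePt I M ∈ reentrantFine d M I := fun i hi => by
  simp only [cornerFinePt, if_pos hi]; omega

/-- M′·𝟙_I is a coarse index (I ≠ ∅). [folklore] -/
theorem cornerCoarseIdx_mem {M' : ℕ} (hI : I.Nonempty) : cornerCoarseIdx I M' ∈ reentrantCoarse d I := by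
  obtain ⟨i, hi⟩ := hI
  exact ⟨i, hi, by simp only [cornerCoarseIdx, if_pos hi]; omega⟩

/-- The two witness points are at ℓ¹ distance |I| (M = L·M′). [folklore] -/
theorem latL1Dist_cornerWitness {M' : ℕ} (hM : M = L * M') :
    latL1Dist (cornerFinePt I M) (scalePt L (cornerCoarseIdx I M')) = I.card := by
  have hMM : (M : ℤ) = (L : ℤ) * M' := by rw [hM]; push_cast; ring
  unfold latL1Dist
  have hpt : ∀ i : Fin d, (cornerFinePt I M i - scalePt L (cornerCoarseIdx I M') i).natAbs = if i ∈ I then 1 else 0 := by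
    intro i
    rw [scalePt_apply]
    simp only [cornerFinePt, cornerCoarseIdx]
    split_ifs with h
    · rw [← hMM]; omega
    · simp
  simp_rw [hpt]
  rw [Finset.sum_ite_mem, Finset.univ_inter, Finset.sum_const, smul_eq_mul, mul_one]

/-- The potential of the fine witness point is |I|·L (1 ≤ L ≤ M). [folklore] -/
theorem cornerPotential_cornerFinePt (hL : 1 ≤ L) (hLM : L ≤ M) :
    cornerPotential I M L (cornerFinePt I M) = I.card * L := by
  unfold cornerPotential
  rw [Finset.sum_congr rfl fun i hi => by rw [show cornerFinePt I M i = (M : ℤ) - 1 by simp only [cornerFinePt, if_pos hi]],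
    Finset.sum_const, smul_eq_mul, cornerPot_pred hL hLM]

/-- The potential of the coarse witness point is 0 (M = L·M′). [folklore] -/
theorem cornerPotential_cornerCoarse {M' : ℕ} (hM : M = L * M') :
    cornerPotential I M L (scalePt L (cornerCoarseIdx I M')) = 0 := by
  have hMM : (M : ℤ) = (L : ℤ) * M' := by rw [hM]; push_cast; ring
  unfold cornerPotential
  refine Finset.sum_eq_zero fun i hi => ?_
  rw [scalePt_apply, show cornerCoarseIdx I M' i = (M' : ℤ) by simp only [cornerCoarseIdx, if_pos hi], ← hMM]
  exact cornerPot_self M L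

/-- **SHARPNESS of the re-entrant constant**: for every M ∈ L·ℕ₊ (M = L·M′, M′ ≥ 1, L ≥ 1) and every nonempty set I of
re-entrant directions, the fine point (M − 1)·𝟙_I and the coarse point M·𝟙_I = L·(M′·𝟙_I) are at ℓ¹ distance |I| and at
re-entrant graph distance EXACTLY |I|·L = ‖u − v‖₁ + |I|·(L − 1): the upper bound is `reentrant_reachable_dist`, the
lower bound the 1-Lipschitz corner potential (|I|·L at the fine point, 0 at the coarse one).  So the additive constant
m(L − 1) of the comparison is attained for every admissible block size, not only for M = L. [folklore] -/
theorem reentrant_dist_cornerWitness {M' : ℕ} (hL : 1 ≤ L) (hM' : 0 < M') (hM : M = L * M') (hI : I.Nonempty) :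
    (reentrantGraph d L M I).dist (cornerFinePt I M) (scalePt L (cornerCoarseIdx I M')) = I.card * L ∧
      latL1Dist (cornerFinePt I M) (scalePt L (cornerCoarseIdx I M')) = I.card := by
  have hLM : L ≤ M := by rw [hM]; exact Nat.le_mul_of_pos_right L hM'
  have hMpos : 0 < M := lt_of_lt_of_le (by omega) hLM
  have hu : cornerFinePt I M ∈ reentrantPts d L M I := Or.inl cornerFinePt_mem
  have hv : scalePt L (cornerCoarseIdx I M') ∈ reentrantPts d L M I := Or.inr ⟨_, cornerCoarseIdx_mem hI, rfl⟩
  have hℓ := latL1Dist_cornerWitness (I := I) hM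
  refine ⟨le_antisymm ?_ ?_, hℓ⟩
  · have h := (reentrant_reachable_dist hMpos hL hu hv).2
    rw [hℓ] at h
    have : I.card * L = I.card * (L - 1) + I.card := by
      conv_lhs => rw [show L = (L - 1) + 1 by omega]
      ring
    omega
  · have h := le_add_dist_of_adj_le (cornerPotential I M L) (fun _ _ h => cornerPotential_le_of_adj hL hM h)
      (reentrant_reachable_dist hMpos hL hu hv).1
    rw [cornerPotential_cornerFinePt hL hLM, cornerPotential_cornerCoarse hM] at h
    omega


/-! ### 10f. The window sum of (2.66) at a corner: the constant of §9c with the corner's additive term [folklore] -/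

/-- One term of the window sum under a comparison dist ≤ ‖u − v‖₁ + K (any bond graph on the η-lattice points, δ₀ ≥ 0):
e^{−δ₀‖u − v‖₁}·e^{½δ₀·dist(u,v)} ≤ e^{½δ₀K}·e^{−½δ₀‖u − v‖₁}. [folklore] -/
theorem windowTerm_le_of_cmp {G : SimpleGraph (Site d)} {K : ℕ} {δ₀ : ℝ} (hδ : 0 ≤ δ₀) {u v : Site d}
    (h : G.dist u v ≤ latL1Dist u v + K) :
    Real.exp (-(δ₀ * (latL1Dist u v : ℝ))) * Real.exp (δ₀ / 2 * (G.dist u v : ℝ)) ≤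
      Real.exp (δ₀ / 2 * (K : ℝ)) * Real.exp (-(1 / 2 * δ₀ * (latL1Dist u v : ℝ))) := by
  have h' : (G.dist u v : ℝ) ≤ (latL1Dist u v : ℝ) + (K : ℝ) := by exact_mod_cast h
  rw [← Real.exp_add, ← Real.exp_add]
  apply Real.exp_le_exp.2
  have := mul_le_mul_of_nonneg_left h' (by positivity : (0 : ℝ) ≤ δ₀ / 2)
  linarith

/-- The window sum under a comparison dist ≤ ‖u − v‖₁ + K on S: Σ_{v∈S} e^{−δ₀‖u − v‖₁}·e^{½δ₀·dist(u,v)} ≤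
e^{½δ₀K}·c₀(δ₀, ½)^d (δ₀ > 0) — `sum_exp_neg_latL1Dist_le_c0_pow` of §9a. [folklore] -/
theorem windowSum_le_of_cmp {G : SimpleGraph (Site d)} {K : ℕ} {δ₀ : ℝ} (hδ : 0 < δ₀) (u : Site d)
    (S : Finset (Site d)) (h : ∀ v ∈ S, G.dist u v ≤ latL1Dist u v + K) :
    ∑ v ∈ S, Real.exp (-(δ₀ * (latL1Dist u v : ℝ))) * Real.exp (δ₀ / 2 * (G.dist u v : ℝ)) ≤
      Real.exp (δ₀ / 2 * (K : ℝ)) * B6.c0 δ₀ (1 / 2) ^ d := by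
  calc ∑ v ∈ S, Real.exp (-(δ₀ * (latL1Dist u v : ℝ))) * Real.exp (δ₀ / 2 * (G.dist u v : ℝ))
      ≤ ∑ v ∈ S, Real.exp (δ₀ / 2 * (K : ℝ)) * Real.exp (-(1 / 2 * δ₀ * (latL1Dist u v : ℝ))) :=
        Finset.sum_le_sum fun v hv => windowTerm_le_of_cmp hδ.le (h v hv)
    _ = Real.exp (δ₀ / 2 * (K : ℝ)) * ∑ v ∈ S, Real.exp (-(1 / 2 * δ₀ * (latL1Dist u v : ℝ))) := by
        rw [Finset.mul_sum]
    _ ≤ Real.exp (δ₀ / 2 * (K : ℝ)) * B6.c0 δ₀ (1 / 2) ^ d :=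
        mul_le_mul_of_nonneg_left (sum_exp_neg_latL1Dist_le_c0_pow (by positivity) u S) (Real.exp_pos _).le

/-- The last «≤» of (2.66) under a comparison dist ≤ ‖y − y″‖₁ + K and reachability on S (scale-correct weights as in
§9c): Σ_{y″∈S} e^{−δ₀‖y − y″‖₁}·e^{−½δ₀·d(y″,y′)} ≤ e^{½δ₀K}·c₀(δ₀, ½)^d·e^{−½δ₀·d(y,y′)} (δ₀ > 0). [folklore] -/
theorem sum266_le_of_cmp {G : SimpleGraph (Site d)} {K : ℕ} {δ₀ : ℝ} (hδ : 0 < δ₀) {y : Site d} (y' : Site d)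
    (S : Finset (Site d)) (hreach : ∀ y'' ∈ S, G.Reachable y y'')
    (h : ∀ y'' ∈ S, G.dist y y'' ≤ latL1Dist y y'' + K) :
    ∑ y'' ∈ S, Real.exp (-(δ₀ * (latL1Dist y y'' : ℝ))) * Real.exp (-(δ₀ / 2 * (G.dist y'' y' : ℝ))) ≤
      Real.exp (δ₀ / 2 * (K : ℝ)) * B6.c0 δ₀ (1 / 2) ^ d * Real.exp (-(δ₀ / 2 * (G.dist y y' : ℝ))) := by
  have hterm : ∀ y'' ∈ S, Real.exp (-(δ₀ * (latL1Dist y y'' : ℝ))) * Real.exp (-(δ₀ / 2 * (G.dist y'' y' : ℝ))) ≤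
      (Real.exp (-(δ₀ * (latL1Dist y y'' : ℝ))) * Real.exp (δ₀ / 2 * (G.dist y y'' : ℝ))) *
        Real.exp (-(δ₀ / 2 * (G.dist y y' : ℝ))) := by
    intro y'' hy''
    have htri' : (G.dist y y' : ℝ) ≤ (G.dist y y'' : ℝ) + (G.dist y'' y' : ℝ) := by
      exact_mod_cast (hreach y'' hy'').dist_triangle_left y'
    rw [mul_assoc]
    refine mul_le_mul_of_nonneg_left ?_ (Real.exp_pos _).le
    rw [← Real.exp_add]
    apply Real.exp_le_exp.2
    have := mul_le_mul_of_nonneg_left htri' (by positivity : (0 : ℝ) ≤ δ₀ / 2)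
    linarith
  calc ∑ y'' ∈ S, Real.exp (-(δ₀ * (latL1Dist y y'' : ℝ))) * Real.exp (-(δ₀ / 2 * (G.dist y'' y' : ℝ)))
      ≤ ∑ y'' ∈ S, (Real.exp (-(δ₀ * (latL1Dist y y'' : ℝ))) * Real.exp (δ₀ / 2 * (G.dist y y'' : ℝ))) *
          Real.exp (-(δ₀ / 2 * (G.dist y y' : ℝ))) := Finset.sum_le_sum hterm
    _ = (∑ y'' ∈ S, Real.exp (-(δ₀ * (latL1Dist y y'' : ℝ))) * Real.exp (δ₀ / 2 * (G.dist y y'' : ℝ))) *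
          Real.exp (-(δ₀ / 2 * (G.dist y y' : ℝ))) := by rw [Finset.sum_mul]
    _ ≤ _ := mul_le_mul_of_nonneg_right (windowSum_le_of_cmp hδ y S h) (Real.exp_pos _).le

/-- **The last «≤» of (2.66) at a SALIENT corner**: the flat constant e^{½δ₀(L−1)}·c₀(δ₀, ½)^d of `twoScale_sum266_le`
(y ∈ T, finite S ⊆ T; δ₀ > 0; M, L ≥ 1). [folklore] -/
theorem salient_sum266_le (hM : 0 < M) (hL : 1 ≤ L) {δ₀ : ℝ} (hδ : 0 < δ₀) {y : Site d} (hy : y ∈ salientPts d L M I)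
    (y' : Site d) (S : Finset (Site d)) (hS : ∀ y'' ∈ S, y'' ∈ salientPts d L M I) :
    ∑ y'' ∈ S, Real.exp (-(δ₀ * (latL1Dist y y'' : ℝ))) *
        Real.exp (-(δ₀ / 2 * ((salientGraph d L M I).dist y'' y' : ℝ))) ≤
      Real.exp (δ₀ / 2 * ((L : ℝ) - 1)) * B6.c0 δ₀ (1 / 2) ^ d *
        Real.exp (-(δ₀ / 2 * ((salientGraph d L M I).dist y y' : ℝ))) := by
  have hL1 : ((L - 1 : ℕ) : ℝ) = (L : ℝ) - 1 := by rw [Nat.cast_sub hL, Nat.cast_one]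
  rw [← hL1]
  exact sum266_le_of_cmp hδ y' S (fun y'' hy'' => (salient_reachable_dist hM hL hy (hS y'' hy'')).1)
    (fun y'' hy'' => (salient_reachable_dist hM hL hy (hS y'' hy'')).2)

/-- **The last «≤» of (2.66) at a RE-ENTRANT corner**: constant e^{½δ₀·m(L−1)}·c₀(δ₀, ½)^d, m = |I| ≤ d — depending on
d, L, δ₀ only, UNIFORM IN M (y ∈ T, finite S ⊆ T; δ₀ > 0; M, L ≥ 1). [folklore] -/
theorem reentrant_sum266_le (hM : 0 < M) (hL : 1 ≤ L) {δ₀ : ℝ} (hδ : 0 < δ₀) {y : Site d}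
    (hy : y ∈ reentrantPts d L M I) (y' : Site d) (S : Finset (Site d))
    (hS : ∀ y'' ∈ S, y'' ∈ reentrantPts d L M I) :
    ∑ y'' ∈ S, Real.exp (-(δ₀ * (latL1Dist y y'' : ℝ))) *
        Real.exp (-(δ₀ / 2 * ((reentrantGraph d L M I).dist y'' y' : ℝ))) ≤
      Real.exp (δ₀ / 2 * (I.card * ((L : ℝ) - 1))) * B6.c0 δ₀ (1 / 2) ^ d *
        Real.exp (-(δ₀ / 2 * ((reentrantGraph d L M I).dist y y' : ℝ))) := by
  have hL1 : ((I.card * (L - 1) : ℕ) : ℝ) = I.card * ((L : ℝ) - 1) := by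
    rw [Nat.cast_mul, Nat.cast_sub hL, Nat.cast_one]
  rw [← hL1]
  exact sum266_le_of_cmp hδ y' S (fun y'' hy'' => (reentrant_reachable_dist hM hL hy (hS y'' hy'')).1)
    (fun y'' hy'' => (reentrant_reachable_dist hM hL hy (hS y'' hy'')).2)

end Corner

end Literature.MathematicalPhysics.QuantumFieldTheory.Balaban1983to89.B6BoxChartsCorners
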